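import Summits.CriticalPhenomena.CardyFormulaZ2.Theses.CardyQContinuation
import Literature.Probability.RandomPlanarGeometry.AffineInterp

/-!
# Closed polygons with pairwise close vertices are uniformly close
(route CardyQContinuation, serves stmt-CriticalPhenomena-5560, registered stub
`stub_loopSymmetricLimit_polygonLoop_dist_le` of the n = 0 bridge of the crux `IsingJetsConformal`)

In the n = 0 bridge of the crux the polygonal domains of the designed lattice quadrilaterals and of
the designed rectilinear polygons are presented as `polygonDomain l h`, the inside of the closed
polygon `polygonLoop l` (`Literature/Probability/RandomPlanarGeometry/AffineInterp.lean`), and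
Radó's theorem on the convergence of Riemann maps needs UNIFORM convergence of the boundary loops
`polygonLoop l_δ → polygonLoop l`. This file is the elementary estimate behind it:

* `PolygonLoopDistLe.dist_polygonLoop_le` — two closed polygons whose vertex lists have the same
  length `N` and whose corresponding vertices are within `C` are within `C` at every time `t`.

Proof: by `polygonLoop_eq_of_floor` the point `polygonLoop l t` is `lineMap v_k v_{(k+1) % N} θ`
with `(k + θ) / N = fract t`, and the piece formula `polygonLoop_apply_div` evaluated at the SAME
`k, θ` (they only depend on `N` and `t`) gives `polygonLoop l' t = lineMap v'_k v'_{(k+1) % N} θ`;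
two convex combinations with the same coefficient of two `C`-close pairs are `C`-close
(`PolygonLoopDistLe.dist_lineMap_lineMap_le`, the triangle inequality). For `l = []` both lists
are empty and the two (junk) loops coincide. No new mathematics. [folklore]
-/

namespace Summit.CriticalPhenomena.CardyFormulaZ2.Theorems.CardyQContinuation

open Literature.Probability.RandomPlanarGeometry Set

namespace PolygonLoopDistLe

variable {E : Type*} [NormedAddCommGroup E] [NormedSpace ℝ E]

/-- Convex combinations with the same coefficient `θ ∈ [0, 1]` of two `C`-close pairs of points
are `C`-close: `dist (lineMap a₁ b₁ θ) (lineMap a₂ b₂ θ) ≤ (1 - θ) dist a₁ a₂ + θ dist b₁ b₂ ≤ C`.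
[folklore] -/
theorem dist_lineMap_lineMap_le {a₁ a₂ b₁ b₂ : E} {C θ : ℝ} (h0 : 0 ≤ θ) (h1 : θ ≤ 1)
    (ha : dist a₁ a₂ ≤ C) (hb : dist b₁ b₂ ≤ C) :
    dist (AffineMap.lineMap a₁ b₁ θ) (AffineMap.lineMap a₂ b₂ θ) ≤ C := by
  rw [AffineMap.lineMap_apply_module, AffineMap.lineMap_apply_module]
  calc dist ((1 - θ) • a₁ + θ • b₁) ((1 - θ) • a₂ + θ • b₂)
      ≤ dist ((1 - θ) • a₁) ((1 - θ) • a₂) + dist (θ • b₁) (θ • b₂) := dist_add_add_le _ _ _ _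
    _ = (1 - θ) * dist a₁ a₂ + θ * dist b₁ b₂ := by
        rw [dist_smul₀, dist_smul₀, Real.norm_of_nonneg (by linarith), Real.norm_of_nonneg h0]
    _ ≤ (1 - θ) * C + θ * C :=
        add_le_add (mul_le_mul_of_nonneg_left ha (by linarith)) (mul_le_mul_of_nonneg_left hb h0)
    _ = C := by ring

/-- **Closed polygons with pairwise `C`-close vertices are pointwise `C`-close.** If the vertex
lists `l`, `l'` have the same length and `dist l[i] l'[i] ≤ C` for every `i` (and `0 ≤ C`, needed
only when the lists are empty), then `dist (polygonLoop l t) (polygonLoop l' t) ≤ C` for every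
time `t`: both points are the same convex combination `lineMap v_k v_{(k+1) % N} θ` of
corresponding vertices. [folklore] -/
theorem dist_polygonLoop_le {l l' : List E} {C : ℝ} (hC : 0 ≤ C) (h : l.length = l'.length)
    (hd : ∀ (i : ℕ) (hi : i < l.length), dist (l[i]) (l'[i]'(h ▸ hi)) ≤ C) (t : ℝ) :
    dist (polygonLoop l t) (polygonLoop l' t) ≤ C := by
  rcases eq_or_ne l [] with rfl | hl
  · have hl' : l' = [] := by simpa using h.symm
    subst hl'
    simpa using hC
  have hN : 0 < l.length := List.length_pos_iff.2 hl
  obtain ⟨k, hk, θ, hθ, hkθ, hlt⟩ := polygonLoop_eq_of_floor hl t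
  have hk' : k < l'.length := h ▸ hk
  have hlt' : polygonLoop l' t =
      AffineMap.lineMap l'[k] (l'[(k + 1) % l'.length]'(Nat.mod_lt _ (by omega))) θ := by
    rw [← polygonLoop_apply_div hk' ⟨hθ.1, hθ.2.le⟩, ← h, hkθ, polygonLoop_fract]
  rw [hlt, hlt']
  refine dist_lineMap_lineMap_le hθ.1 hθ.2.le (hd k hk) ?_
  have hmod : (k + 1) % l.length < l.length := Nat.mod_lt _ hN
  have e : l'[(k + 1) % l'.length]'(Nat.mod_lt _ (by omega)) =
      l'[(k + 1) % l.length]'(h ▸ hmod) :=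
    getElem_congr_idx (by rw [h])
  rw [e]
  exact hd _ hmod

end PolygonLoopDistLe

open PolygonLoopDistLe in
/-- **Registered stub `stub_loopSymmetricLimit_polygonLoop_dist_le`** of the n = 0 bridge of the
crux `IsingJetsConformal` (stmt-CriticalPhenomena-5560): two closed polygons in `ℂ` whose vertex
lists have the same length and whose corresponding vertices are within `C ≥ 0` are within `C` at
every time `t`. [folklore] -/
theorem stub_loopSymmetricLimit_polygonLoop_dist_le : (∀ (l l' : List ℂ) (C : ℝ), 0 ≤ C → ∀ (h : l.length = l'.length), (∀ (i : ℕ) (hi : i < l.length), dist (l[i]) (l'[i]'(h ▸ hi)) ≤ C) → ∀ t : ℝ, dist (Literature.Probability.RandomPlanarGeometry.polygonLoop l t) (Literature.Probability.RandomPlanarGeometry.polygonLoop l' t) ≤ C) := by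
  intro l l' C hC h hd t
  exact dist_polygonLoop_le hC h hd t

end Summit.CriticalPhenomena.CardyFormulaZ2.Theorems.CardyQContinuation
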